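import Summits.BirchSwinnertonDyer.BirchSwinnertonDyer.Theorems.UniversalToricDescentSigmaCongruenceAtThreeIffInvariantPair
import Summits.BirchSwinnertonDyer.BirchSwinnertonDyer.Theorems.UniversalToricDescentBDPFrameCrossPeriodRigidity
import Summits.BirchSwinnertonDyer.BirchSwinnertonDyer.Theorems.UniversalToricDescentSigmaCongruenceOfEqualProfiles
import HarnessLib

/-!
# NODE g15 on crux A = `SigmaCongruenceAtThree` (stmt-BirchSwinnertonDyer-27120, route `UniversalToricDescent`, r201):
# `nguyen-epw-wild-port` — A is the anticyclotomic Emerton–Pollack–Weston theorem of T. Nguyen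
# (arXiv:2503.00247, Thm. 5.10, first display) with ONE WILD MEMBER; the kernel-checked reduction
# A ⟸ A′ + H through the tree's cross-period rigidity, and the port plan for A′

Crux-ideate standing cover, generation 15 (planner-cruxidea-stmt-BirchSwinnertonDyer-27120-1-g15-0, kit 0, 2026-08-31).
Parent ♭T≤ = `DefectTransportModThreePT` (stmt-23042). BSD is not advanced by this file: it closes NOTHING of A; it
re-targets the line of record (`Lines/sqrt_toric_functional.lean`, stub F = construct the square-root toric functional,
XL) to a PORT of a printed two-page proof and certifies the bookkeeping around it.

## The observation (new to this crux's pool: 0 prior citations of arXiv:2503.00247 under `Cruxes/SigmaCongruenceAtThree/`)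

T. Nguyen, *Congruent modular forms and anticyclotomic Iwasawa theory* (arXiv:2503.00247, 2025) proves, for newforms
`f₁ ∈ S_{2r₁}(Γ₀(N₁))`, `f₂ ∈ S_{2r₂}(Γ₀(N₂))` with (Heeg) for `K`, `p` odd split, and semisimplified mod-`ϖ^m` Galois
representations isomorphic [p0012 Thm. 5.10]:
  `∏_{ℓ∣N₁N₂} 𝒫_{v̄}(f₁) · 𝓛_𝔭(f₁) ≡ ∏_{ℓ∣N₁N₂} 𝒫_{v̄}(f₂) · 𝓛_𝔭(f₂)  (mod ϖ^m 𝒲⟦Γ_K^−⟧)`,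
hence `μ(𝓛_𝔭(f₁)) = 0 ↔ μ(𝓛_𝔭(f₂)) = 0` and, when both vanish, `Σ λ(𝒫_{v̄}(f₁)) + λ(𝓛_𝔭(f₁)) = Σ λ(𝒫_{v̄}(f₂)) + λ(𝓛_𝔭(f₂))`
[p0013 L1–L12] — LITERALLY the Σ-depleted congruence A and the λ-identity of p705895, in `𝔽̄_p⟦T⟧`. The proof is
Lemma 5.1 [p0009]: congruent q-expansions ⇒ `f₁^♭ ≡ f₂^♭` as `p`-adic modular forms (q-expansion principle [Hid04]) ⇒
`𝓛_𝔭(f₁) ≡ 𝓛_𝔭(f₂) (mod ϖ^m 𝒲⟦Γ⟧)` "by the same argument as [Vat99]", plus the `ℓ`-depletion law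
`𝓛_𝔭(f^{(N₁N₂)}) = ∏ 𝒫_{v̄}(f)·𝓛_𝔭(f)` (his Thm. "(l-dep-2)", `ℓ ≠ p`). Its ONLY hypothesis our pair violates is the standing
«Fix an odd prime `p ∤ N`» [p0003 L3]: `f₁ = f_E` has `27 ∣ N` (ClassO6). The port's non-verbatim inputs at `3 ∣ N₁` are
(i) weight-2 `3`-adic modular forms of level `Γ₀(N^#)`, `3 ∣ N^#`, on the ordinary locus `D ⊂ X₀(N^#)` cut out by the
canonical subgroup, with the q-expansion principle there — PRINTED for `p ∣ N`: Kriz–Li 2019 §3.2 Def. 3.2, §3.6 proof of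
Thm. 3.9 [corpus:paper:doi-10-1017-fms-2019-9 p0009 L47 – p0010 L11: "applying the q-expansion principle … as weight 0
p-adic modular forms on D over 𝒪_{ℂ_p}"; p0005 L15: "we work on X₀(N) directly … and we do not require E to have good
reduction at p"]; (ii) the CM points with `𝔑 ∋ 𝔭^{v₃(N)}` (Kriz–Li p0019 L19 «`p ∣ 𝔑` if `p ∣ N`») and the any-level
interpolation constant at the wild form = the tree's accepted reading (E1″) of Hsieh 2014 Thm. A
(`Literature/…/Hsieh2014/AnticyclotomicPAdicLFunctionAnyLevel.lean`); (iii) `f_E = f_E^♭` (`a₃(E) = 0`). Nothing else in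
the proof of Thm. 5.10 sees the level at `p`.

## Pieces (tags per D-0171) and the decider

* P1 `HeckeCongruenceAtThree` — verbatim stub H of the line of record. WEAKER than A · ATTACKABLE (M).
* P2 `SigmaCongruenceOfCongruentExpansions` (= A′, "A in print shape"): for ANY two modular parametrisations `(W,N,Dt)`,
  `(W′,N′,Dt′)` with `a_n(W) ≡ a_n(W′) (mod 3)` for `(n, 3NN′) = 1`, (Heeg) for both, `3 = 𝔭𝔭′` split, branch data, and A's
  `(T, c)`: THERE ARE frames `𝓛, 𝓛′` (own periods), exponents `e` and a unit `u` with `𝓛·Π_W(e) ≡ u·𝓛′·Π_{W′}(e) (mod 𝔪_{R₀})`.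
  No `ClassO6`, no surjectivity, no rank, no `ModPCongruent`, no `Addv`, no `μ(𝓛′) = 0`, no constants, no `Θ`.
  Formally STRONGER than A (weaker hypotheses; conclusion equivalent to A's by rigidity); UNDECIDED; ATTACKABLE by the
  port above. EQUIV-strength ⇒ child decomposition (§4 of `NodeNguyenEpwWildPort.md`): P2 ⟸ P2a measure congruence
  (Nguyen L.5.1 at level `Γ₀(N^#)`, `27 ∣ N^#`; needs vocabulary D1 = ordinary-locus `3`-adic modular forms as q-expansion
  module with CM-point t-expansion measure — IDEA-NEEDED→typing) + P2b `ℓ`-depletion law for `ℓ ≠ 3` (Nguyen (l-dep-2);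
  ATTACKABLE given D1; algebraic shadow in tree: `UniversalToricDescentAnticyclotomicEulerFactor`) + P2c frames exist
  (PROVED in tree: `UniversalToricDescentSelfMuZero.self_exists_isBDPLFunctionInt_coeff_norm_eq_one`, twin analogue).
* P3 `SigmaCongruenceOfCongruentExpansionsTame` — P2 restricted to `3 ∤ N`, `3 ∤ N′`: PRINT leaf = Nguyen Thm. 5.10 verbatim
  (weight 2, trivial character, `m = 1`); to be typed as a Literature fact (`Nguyen2025/…`), the tame rung of P2's family.
  `tame_of_all : P2 → P3` (trivial) records the nesting.
* DECIDER `sigmaCongruenceAtThree_of_congruentExpansions : P2 → P1 → A` BY NAME, sorry-free: Hecke congruence from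
  `ModPCongruent` (P1), frames from P2, then `UniversalToricDescentTwinSplit.span_singleton_eq_of_isBDPLFunction`
  (p-cross-period rigidity: any two frames of the same form are unit multiples) moves the congruence to A's given frames;
  `UniversalToricDescentNormProfile.forall_norm_coeff_mul_lt_one` finishes. A's idle hypotheses stay idle.
* §5 toy certificate for the KEEP/KILL refinement R-g15-1 of g14's JT-a (`NodeHondaKummerLedger.md`): a local ring has at
  most ONE ring map to `𝔽₃` (`ringHom_zmod_three_unique`) — the reason transport of Σ-stabilised Kummer classes along
  `J₀(L)[𝔪] ↠ E[3], E′[3]` is free exactly in the multiplicity-one case.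

Barriers: B-g11-1 (residual-only transport at wild level) is HONOURED — the port is residual transport; B-g11-2 (Rankin–
Selberg level index) does not apply — no Petersson product (this is where `rankin-selberg-linearity-transplant` died);
B-g11-5 (small-disc value precision) does not apply — Lemma 5.1 is a congruence of MEASURES in `𝒲⟦Γ⟧`, not of values;
B-g14-2 (wild multiplicity) is not met — no Jacobian. Negatives index: no refuted statement of the summit is used
(`ledger negatives --problem BirchSwinnertonDyer`: none concerns Σ-congruence frames).

THEOREMS + typed `Prop`s only; no `sorry`; no named fact minted; no instance, no notation.
References: [Nguyen2025] arXiv:2503.00247 Lemma 5.1, Thm. 5.10 (p0009, p0012–p0013); [KrizLi2019] Forum Math. Sigma 7 e15,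
§3.1–3.6 (doi:10.1017/fms.2019.9); [Hida2004] (q-expansion principle); [Vatsal1999] Duke 98; [Hsieh2014] Thm. A/B;
[Castella2018] Thm. 3.1 (rigidity currency); tree p705895, p722334, `UniversalToricDescentBDPFrameCrossPeriodRigidity`.
-/

set_option linter.dupNamespace false
set_option autoImplicit false

noncomputable section

open scoped Classical NumberField
open NumberField IsDedekindDomain Field PowerSeries
open Literature.NumberTheory.EllipticCurves
open Literature.NumberTheory.EllipticCurves.ModularForms

namespace Summit.BirchSwinnertonDyer.BirchSwinnertonDyer.Cruxes.SigmaCongruenceAtThree.NguyenEpwWildPort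

/-! ### §1 P1 — the Hecke congruence of the depleted q-expansions (verbatim stub H of the line of record) -/

/-- **P1 (WEAKER than A · ATTACKABLE, M).** For `3`-congruent minimal curves `E′ ∼ E` of conductors `N, N′`:
`a_n(E) ≡ a_n(E′) (mod 3)` for every `n` prime to `3NN′`. Verbatim the statement of `stub_heckeCongruence` of
`Lines/sqrt_toric_functional.lean`. [cite: DiamondShurman2005, Prop. 5.8.5] [cite: SilvermanAEC2009, C.21 Remark 21.3] -/
def HeckeCongruenceAtThree : Prop :=
  ∀ (W : WeierstrassCurve ℚ) [W.IsElliptic] [W.IsGloballyMinimal] (W' : WeierstrassCurve ℚ) [W'.IsElliptic]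
    [W'.IsGloballyMinimal] (N N' : ℕ), W.conductorNorm ℤ = N → W'.conductorNorm ℤ = N' →
    Summit.BirchSwinnertonDyer.Rank1Residual.O6.ModPCongruent W' W 3 →
    ∀ n : ℕ, Nat.Coprime n (3 * (N * N')) → (3 : ℤ) ∣ W.LFunction n - W'.LFunction n

/-! ### §2 P2 — A in print shape: Nguyen's Thm. 5.10 (first display) for weight-2 elliptic newforms, ANY level at `3` -/

/-- **P2 = A′ (formally STRONGER than A; UNDECIDED; ATTACKABLE by port of arXiv:2503.00247 L.5.1/Thm.5.10 with Kriz–Li's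
`p ∣ N` ordinary locus).** Congruent prime-to-`3NN′` q-expansions ⇒ SOME frames of the two newforms have Σ-depleted
products congruent mod `𝔪_{R₀}` up to a unit, with A's exponent clause. The sub-case `3 ∤ NN′` is Nguyen's theorem verbatim
(§3); the case `27 ∣ N` is the port. [cite: Nguyen2025, Thm. 5.10 (arXiv:2503.00247 p. 12)]
[cite: KrizLi2019, §3.1, §3.6 (Forum Math. Sigma 7 e15)] -/
def SigmaCongruenceOfCongruentExpansions : Prop :=
  ∀ (W : WeierstrassCurve ℚ) [W.IsElliptic] [W.IsGloballyMinimal] (W' : WeierstrassCurve ℚ) [W'.IsElliptic] [W'.IsGloballyMinimal] (N N' : ℕ) [NeZero N] [NeZero N'] (K : Type) [Field K] [NumberField K] (Dt : Literature.NumberTheory.EllipticCurves.ModularForms.ModularParametrizationData W N) (Dt' : Literature.NumberTheory.EllipticCurves.ModularForms.ModularParametrizationData W' N'), W.conductorNorm ℤ = N → W'.conductorNorm ℤ = N' → (∀ n : ℕ, Nat.Coprime n (3 * (N * N')) → (3 : ℤ) ∣ W.LFunction n - W'.LFunction n) → Literature.NumberTheory.EllipticCurves.IsImaginaryQuadratic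 K → Literature.NumberTheory.EllipticCurves.SatisfiesHeegnerHypothesis N K → Literature.NumberTheory.EllipticCurves.SatisfiesHeegnerHypothesis N' K → ∀ (κ : Literature.NumberTheory.EllipticCurves.ZpExtension K 3), κ.IsAnticyclotomic → ∀ (γ : Field.absoluteGaloisGroup K) [Fact (κ.IsTopGenerator γ)] (𝔭 : IsDedekindDomain.HeightOneSpectrum (NumberField.RingOfIntegers K)), ((3 : ℕ) : NumberField.RingOfIntegers K) ∈ 𝔭.asIdeal → 𝔭.asIdeal.ramificationIdx (NumberField.RingOfIntegers ℚ) = 1 → 𝔭.asIdeal.inertiaDeg (NumberField.RingOfIntegers ℚ) = 1 → ∀ (𝔭' : IsDedekindDomain.HeightOneSpectrum (NumberField.RingOfIntegers K)), ((3 : ℕ) : NumberField.RingOfIntegers K) ∈ 𝔭'.asIdeal → 𝔭' ≠ 𝔭 → ∀ (ι' : PadicAlgCl 3 ≃+* ℂ), Summit.BirchSwinnertonDyer.BirchSwinnertonDyer.Theorems.SchneiderFree.BranchInducesPrime 3 ι' 𝔭 → ∀ (T : Finset (IsDedekindDomain.HeightOneSpectrum (NumberField.RingOfIntegers K))) (c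 : IsDedekindDomain.HeightOneSpectrum (NumberField.RingOfIntegers K) → ℕ), (↑T = {v : IsDedekindDomain.HeightOneSpectrum (NumberField.RingOfIntegers K) | ((3 : ℕ) : NumberField.RingOfIntegers K) ∉ v.asIdeal ∧ (¬ (W.baseChange K).HasGoodReductionAt v ∨ ¬ (W'.baseChange K).HasGoodReductionAt v)}) → (∀ v ∈ T, (∃ d₀ : Literature.NumberTheory.EllipticCurves.GreenbergSelmer.decomp (K := K) v, (κ (d₀ : Field.absoluteGaloisGroup K)).toAdd = (3 : ℤ_[3]) ^ c v) ∧ (∀ d : Literature.NumberTheory.EllipticCurves.GreenbergSelmer.decomp (K := K) v, (3 : ℤ_[3]) ^ c v ∣ (κ (d : Field.absoluteGaloisGroup K)).toAdd)) → ∃ (ΩK : ℂ) (Ωp : ℂ_[3]) (L : Literature.NumberTheory.EllipticCurves.UnrSeries 3) (ΩK' : ℂ) (Ωp' : ℂ_[3]) (L' : Literature.NumberTheory.EllipticCurves.UnrSeries 3) (e : IsDedekindDomain.HeightOneSpectrum (NumberField.RingOfIntegers K) → ℤ_[3]) (u : Literature.NumberTheory.EllipticCurves.UnrSeries 3), ΩK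 ≠ 0 ∧ Ωp ≠ 0 ∧ Literature.NumberTheory.EllipticCurves.IsBDPLFunction ι' 𝔭 κ γ Dt.f ΩK Ωp L ∧ ΩK' ≠ 0 ∧ Ωp' ≠ 0 ∧ Literature.NumberTheory.EllipticCurves.IsBDPLFunction ι' 𝔭 κ γ Dt'.f ΩK' Ωp' L' ∧ IsUnit u ∧ (∀ v ∈ T, e v ≠ 0 ∧ (e v).valuation = c v) ∧ ∀ i : ℕ, ‖((PowerSeries.coeff i (L * PowerSeries.map (Summit.BirchSwinnertonDyer.Rank1Residual.X11b.Halves.toUnr 3) (∏ v ∈ T, (Polynomial.aeval (PowerSeries.C ((Nat.card (IsLocalRing.ResidueField (v.adicCompletionIntegers K)) : ℤ_[3]).inv) * PowerSeries.binomialSeries ℤ_[3] (e v)) ((W.baseChange K).localPolynomialAt v) : Literature.NumberTheory.EllipticCurves.IwasawaAlgebra 3)) - u * (L' * PowerSeries.map (Summit.BirchSwinnertonDyer.Rank1Residual.X11b.Halves.toUnr 3) (∏ v ∈ T, (Polynomial.aeval (PowerSeries.C ((Nat.card (IsLocalRing.ResidueField (v.adicCompletionIntegers K)) : ℤ_[3]).inv)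 * PowerSeries.binomialSeries ℤ_[3] (e v)) ((W'.baseChange K).localPolynomialAt v) : Literature.NumberTheory.EllipticCurves.IwasawaAlgebra 3)))) : Literature.NumberTheory.EllipticCurves.unrIntegers 3) : ℂ_[3])‖ < 1

/-! ### §3 P3 — the PRINT leaf: the tame regime `3 ∤ NN′` (Nguyen Thm. 5.10 verbatim, weight 2, `m = 1`) -/

/-- **P3 (PRINT leaf; to be a Literature fact `Nguyen2025.…`).** P2 with both levels prime to `3` — the printed theorem
(standing «odd prime `p ∤ N`», arXiv:2503.00247 p. 3; Thm. 5.10 p. 12; the congruence "also holds over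
`𝒲⟦Γ⟧/ϖ ≃ 𝔽̄_p⟦T⟧`", p. 13), read in the route's frame currency (Castella 2018 Thm. 3.1 frames; cross-period rigidity makes
the choice of periods immaterial). [cite: Nguyen2025, Thm. 5.10 (arXiv:2503.00247 p. 12–13)] -/
def SigmaCongruenceOfCongruentExpansionsTame : Prop :=
  ∀ (W : WeierstrassCurve ℚ) [W.IsElliptic] [W.IsGloballyMinimal] (W' : WeierstrassCurve ℚ) [W'.IsElliptic] [W'.IsGloballyMinimal] (N N' : ℕ) [NeZero N] [NeZero N'] (K : Type) [Field K] [NumberField K] (Dt : Literature.NumberTheory.EllipticCurves.ModularForms.ModularParametrizationData W N) (Dt' : Literature.NumberTheory.EllipticCurves.ModularForms.ModularParametrizationData W' N'), ¬ 3 ∣ N → ¬ 3 ∣ N' → W.conductorNorm ℤ = N → W'.conductorNorm ℤ = N' → (∀ n : ℕ, Nat.Coprime n (3 * (N * N')) → (3 : ℤ) ∣ W.LFunction n - W'.LFunction n) → Literature.NumberTheory.EllipticCurves.IsImaginaryQuadratic K → Literature.NumberTheory.EllipticCurves.SatisfiesHeegnerHypothesis N K → Literature.NumberTheory.EllipticCurves.SatisfiesHeegnerHypothesis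 N' K → ∀ (κ : Literature.NumberTheory.EllipticCurves.ZpExtension K 3), κ.IsAnticyclotomic → ∀ (γ : Field.absoluteGaloisGroup K) [Fact (κ.IsTopGenerator γ)] (𝔭 : IsDedekindDomain.HeightOneSpectrum (NumberField.RingOfIntegers K)), ((3 : ℕ) : NumberField.RingOfIntegers K) ∈ 𝔭.asIdeal → 𝔭.asIdeal.ramificationIdx (NumberField.RingOfIntegers ℚ) = 1 → 𝔭.asIdeal.inertiaDeg (NumberField.RingOfIntegers ℚ) = 1 → ∀ (𝔭' : IsDedekindDomain.HeightOneSpectrum (NumberField.RingOfIntegers K)), ((3 : ℕ) : NumberField.RingOfIntegers K) ∈ 𝔭'.asIdeal → 𝔭' ≠ 𝔭 → ∀ (ι' : PadicAlgCl 3 ≃+* ℂ), Summit.BirchSwinnertonDyer.BirchSwinnertonDyer.Theorems.SchneiderFree.BranchInducesPrime 3 ι' 𝔭 → ∀ (T : Finset (IsDedekindDomain.HeightOneSpectrum (NumberField.RingOfIntegers K))) (c : IsDedekindDomain.HeightOneSpectrum (NumberField.RingOfIntegers K) → ℕ), (↑T = {v : IsDedekindDomain.HeightOneSpectrum (NumberField.RingOfIntegers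 K) | ((3 : ℕ) : NumberField.RingOfIntegers K) ∉ v.asIdeal ∧ (¬ (W.baseChange K).HasGoodReductionAt v ∨ ¬ (W'.baseChange K).HasGoodReductionAt v)}) → (∀ v ∈ T, (∃ d₀ : Literature.NumberTheory.EllipticCurves.GreenbergSelmer.decomp (K := K) v, (κ (d₀ : Field.absoluteGaloisGroup K)).toAdd = (3 : ℤ_[3]) ^ c v) ∧ (∀ d : Literature.NumberTheory.EllipticCurves.GreenbergSelmer.decomp (K := K) v, (3 : ℤ_[3]) ^ c v ∣ (κ (d : Field.absoluteGaloisGroup K)).toAdd)) → ∃ (ΩK : ℂ) (Ωp : ℂ_[3]) (L : Literature.NumberTheory.EllipticCurves.UnrSeries 3) (ΩK' : ℂ) (Ωp' : ℂ_[3]) (L' : Literature.NumberTheory.EllipticCurves.UnrSeries 3) (e : IsDedekindDomain.HeightOneSpectrum (NumberField.RingOfIntegers K) → ℤ_[3]) (u : Literature.NumberTheory.EllipticCurves.UnrSeries 3), ΩK ≠ 0 ∧ Ωp ≠ 0 ∧ Literature.NumberTheory.EllipticCurves.IsBDPLFunction ι' 𝔭 κ γ Dt.f ΩK Ωp L ∧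 ΩK' ≠ 0 ∧ Ωp' ≠ 0 ∧ Literature.NumberTheory.EllipticCurves.IsBDPLFunction ι' 𝔭 κ γ Dt'.f ΩK' Ωp' L' ∧ IsUnit u ∧ (∀ v ∈ T, e v ≠ 0 ∧ (e v).valuation = c v) ∧ ∀ i : ℕ, ‖((PowerSeries.coeff i (L * PowerSeries.map (Summit.BirchSwinnertonDyer.Rank1Residual.X11b.Halves.toUnr 3) (∏ v ∈ T, (Polynomial.aeval (PowerSeries.C ((Nat.card (IsLocalRing.ResidueField (v.adicCompletionIntegers K)) : ℤ_[3]).inv) * PowerSeries.binomialSeries ℤ_[3] (e v)) ((W.baseChange K).localPolynomialAt v) : Literature.NumberTheory.EllipticCurves.IwasawaAlgebra 3)) - u * (L' * PowerSeries.map (Summit.BirchSwinnertonDyer.Rank1Residual.X11b.Halves.toUnr 3) (∏ v ∈ T, (Polynomial.aeval (PowerSeries.C ((Nat.card (IsLocalRing.ResidueField (v.adicCompletionIntegers K)) : ℤ_[3]).inv) * PowerSeries.binomialSeries ℤ_[3] (e v)) ((W'.baseChange K).localPolynomialAt v) : Literature.NumberTheory.EllipticCurves.IwasawaAlgebra 3))))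 : Literature.NumberTheory.EllipticCurves.unrIntegers 3) : ℂ_[3])‖ < 1

/-- The nesting P2 ⟹ P3 (the tame regime is a sub-case of the any-level statement). [folklore] -/
theorem tame_of_all (h : SigmaCongruenceOfCongruentExpansions) : SigmaCongruenceOfCongruentExpansionsTame := by
  intro W _ _ W' _ _ N N' _ _ K _ _ Dt Dt' _ _
  exact h W W' N N' K Dt Dt'

/-! ### §4 The DECIDER: A ⟸ P2 + P1, through cross-period rigidity (kernel-checked, no `sorry`) -/

/-- (H1) An identity of principal ideals `(x) = (y)` of `R₀⟦T⟧` gives `y = r·x`. [folklore] -/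
theorem exists_mul_eq_of_span_eq {p : ℕ} [Fact p.Prime] {x y : Literature.NumberTheory.EllipticCurves.UnrSeries p}
    (h : Ideal.span ({x} : Set (Literature.NumberTheory.EllipticCurves.UnrSeries p)) = Ideal.span {y}) :
    ∃ r : Literature.NumberTheory.EllipticCurves.UnrSeries p, r * x = y := by
  have hy : y ∈ Ideal.span ({x} : Set (Literature.NumberTheory.EllipticCurves.UnrSeries p)) := by
    rw [h]; exact Ideal.mem_span_singleton_self y
  exact Ideal.mem_span_singleton'.mp hy

/-- (H2) `(x) = (0)` in `R₀⟦T⟧` forces `x = 0`. [folklore] -/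
theorem eq_zero_of_span_eq_span_zero {p : ℕ} [Fact p.Prime] {x : Literature.NumberTheory.EllipticCurves.UnrSeries p}
    (h : Ideal.span ({x} : Set (Literature.NumberTheory.EllipticCurves.UnrSeries p)) = Ideal.span {0}) : x = 0 := by
  have h' : Ideal.span ({x} : Set (Literature.NumberTheory.EllipticCurves.UnrSeries p)) = ⊥ := by
    rw [h, Ideal.span_singleton_eq_bot]
  exact Ideal.span_singleton_eq_bot.mp h'

/-- (H3) In the domain `R₀⟦T⟧`: `r·(s·y) = y` with `y ≠ 0` forces `r·s = 1`. [folklore] -/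
theorem mul_eq_one_of_mul_mul_eq {p : ℕ} [Fact p.Prime] {r s y : Literature.NumberTheory.EllipticCurves.UnrSeries p}
    (hy : y ≠ 0) (h : r * (s * y) = y) : r * s = 1 := by
  have h1 : (r * s - 1) * y = 0 := by
    rw [sub_mul, one_mul, mul_assoc, h, sub_self]
  rcases mul_eq_zero.mp h1 with h2 | h2
  · exact sub_eq_zero.mp h2
  · exact absurd h2 hy

/-- (H4) A series with a coefficient of norm `1` is non-zero. [folklore] -/
theorem ne_zero_of_exists_norm_coeff_eq_one {p : ℕ} [Fact p.Prime] {L : Literature.NumberTheory.EllipticCurves.UnrSeries p}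
    (h : ∃ i : ℕ, ‖((PowerSeries.coeff i L : Literature.NumberTheory.EllipticCurves.unrIntegers p) : ℂ_[p])‖ = 1) :
    L ≠ 0 := by
  rintro rfl
  obtain ⟨i, hi⟩ := h
  simp at hi

/-- (H5) **Congruence transfer along a frame change** (generic in the Euler products `X, X′`): if
`𝓛₁X ≡ u·𝓛₁′X′ (mod 𝔪_{R₀}⟦T⟧)` and `𝓛 = r·𝓛₁`, `𝓛₁′ = s′·𝓛′`, then `𝓛X ≡ (r u s′)·𝓛′X′ (mod 𝔪_{R₀}⟦T⟧)` —
`𝔪_{R₀}⟦T⟧` is an ideal (`UniversalToricDescentNormProfile.forall_norm_coeff_mul_lt_one`). Any prime `p`. [folklore] -/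
theorem congruence_transfer {p : ℕ} [Fact p.Prime]
    {L L' L₁ L₁' X X' u r s' : Literature.NumberTheory.EllipticCurves.UnrSeries p}
    (hr : r * L₁ = L) (hs' : s' * L' = L₁')
    (hcong : ∀ i : ℕ, ‖((PowerSeries.coeff i (L₁ * X - u * (L₁' * X')) :
      Literature.NumberTheory.EllipticCurves.unrIntegers p) : ℂ_[p])‖ < 1) (i : ℕ) :
    ‖((PowerSeries.coeff i (L * X - (r * u * s') * (L' * X')) :
      Literature.NumberTheory.EllipticCurves.unrIntegers p) : ℂ_[p])‖ < 1 := by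
  have h : L * X - (r * u * s') * (L' * X') = r * (L₁ * X - u * (L₁' * X')) := by
    rw [← hr, ← hs']; ring
  rw [h]
  -- (the ascription fixes the implicit prime before the lemma's binders are unified)
  have key :=
    Summit.BirchSwinnertonDyer.BirchSwinnertonDyer.Theorems.UniversalToricDescentNormProfile.forall_norm_coeff_mul_lt_one
      (u := (r : Literature.NumberTheory.EllipticCurves.UnrSeries p)) hcong i
  exact key

set_option maxHeartbeats 800000 in
/-- **DECIDER. A = `SigmaCongruenceAtThree` BY NAME from P2 (A in print shape, any level at `3`) and P1 (Hecke
congruence).** Proof: P1 turns `E[3] ≅ E′[3]` into the prime-to-`3NN′` q-expansion congruence; P2 yields frames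
`𝓛₁, 𝓛₁′` (their own periods) with `𝓛₁Π ≡ u·𝓛₁′Π′ (mod 𝔪)`; the tree's integral cross-period rigidity
(`UniversalToricDescentTwinSplit.span_singleton_eq_of_isBDPLFunction`: two frames of one form generate the same ideal of
the domain `R₀⟦T⟧`) gives `𝓛 = r·𝓛₁`, `𝓛₁′ = s′·𝓛′` with `s′` a unit (`𝓛′ ≠ 0`: it has a unit coefficient) and `r` a
unit unless `𝓛 = 𝓛₁ = 0` (then `r := 1`); (H5) transports the congruence to the frames GIVEN in A with the unit
`r·u·s′`. A's hypotheses `ClassO6`, surjectivity, rank, `¬Addv` are idle; `μ(𝓛′) = 0` is used only for `𝓛′ ≠ 0`.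
CONDITIONAL on the displayed P2, P1; closes nothing by itself.
[cite: Nguyen2025, Thm. 5.10 (arXiv:2503.00247 p. 12)] [cite: Castella2018, Thm. 3.1 (arXiv:1704.06608 p. 9)] -/
theorem sigmaCongruenceAtThree_of_congruentExpansions
    (hA : SigmaCongruenceOfCongruentExpansions) (hH : HeckeCongruenceAtThree) :
    Summit.BirchSwinnertonDyer.BirchSwinnertonDyer.Theses.UniversalToricDescent.SigmaCongruenceAtThree := by
  haveI : Fact (Nat.Prime 3) := ⟨Nat.prime_three⟩
  unfold Summit.BirchSwinnertonDyer.BirchSwinnertonDyer.Theses.UniversalToricDescent.SigmaCongruenceAtThree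
  intro W _ _ W' _ _ N N' _ _ K _ _ Dt Dt' _hO6 _hsurj _hrk hN hmod _haddv hN' hK hHg hHg' κ hκ γ hγ 𝔭 h𝔭 hram hdeg
    𝔭' h𝔭' hne ι' hι ΩK Ωp L hΩK hΩp hL ΩK' Ωp' L' hΩK' hΩp' hL' hi' T c hT hc
  have hq : ∀ n : ℕ, Nat.Coprime n (3 * (N * N')) → (3 : ℤ) ∣ W.LFunction n - W'.LFunction n :=
    hH W W' N N' hN hN' hmod
  obtain ⟨ΩK₁, Ωp₁, L₁, ΩK₁', Ωp₁', L₁', e, u, hΩK₁, hΩp₁, hL₁, hΩK₁', hΩp₁', hL₁', hu, he, hcong⟩ :=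
    hA W W' N N' K Dt Dt' hN hN' hq hK hHg hHg' κ hκ γ 𝔭 h𝔭 hram hdeg 𝔭' h𝔭' hne ι' hι T c hT hc
  -- cross-period rigidity for `f_E` and for `f_{E′}`
  have hsp : Ideal.span ({L₁} : Set (UnrSeries 3)) = Ideal.span {L} :=
    Summit.BirchSwinnertonDyer.BirchSwinnertonDyer.Theorems.UniversalToricDescentTwinSplit.span_singleton_eq_of_isBDPLFunction
      hK hκ hγ.out hΩK hΩK₁ hΩp hΩp₁ hL hL₁
  have hsp' : Ideal.span ({L₁'} : Set (UnrSeries 3)) = Ideal.span {L'} :=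
    Summit.BirchSwinnertonDyer.BirchSwinnertonDyer.Theorems.UniversalToricDescentTwinSplit.span_singleton_eq_of_isBDPLFunction
      hK hκ hγ.out hΩK' hΩK₁' hΩp' hΩp₁' hL' hL₁'
  -- the twin side: `L' = r'·L₁'`, `L₁' = s'·L'`, and `L' ≠ 0` (it has a unit coefficient) ⇒ `r's' = 1`
  have hL'0 : L' ≠ 0 := ne_zero_of_exists_norm_coeff_eq_one hi'
  obtain ⟨r', hr'⟩ := exists_mul_eq_of_span_eq hsp'
  obtain ⟨s', hs'⟩ := exists_mul_eq_of_span_eq hsp'.symm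
  have hrs' : r' * s' = 1 := mul_eq_one_of_mul_mul_eq hL'0 (by rw [hs', hr'])
  have hs'u : IsUnit s' := IsUnit.of_mul_eq_one r' (by rw [mul_comm, hrs'])
  -- the `E` side: either `L = 0 = L₁` (take `r := 1`) or `L = r·L₁` with `r` a unit
  by_cases hL0 : L = 0
  · have hL₁0 : L₁ = 0 := eq_zero_of_span_eq_span_zero (by rw [hsp, hL0])
    have hr : (1 : UnrSeries 3) * L₁ = L := by rw [hL₁0, hL0, mul_zero]
    exact ⟨e, 1 * u * s', (isUnit_one.mul hu).mul hs'u, he, fun i ↦ congruence_transfer hr hs' hcong i⟩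
  · obtain ⟨r, hr⟩ := exists_mul_eq_of_span_eq hsp
    obtain ⟨s, hs⟩ := exists_mul_eq_of_span_eq hsp.symm
    have hrs : r * s = 1 := mul_eq_one_of_mul_mul_eq hL0 (by rw [hs, hr])
    have hru : IsUnit r := IsUnit.of_mul_eq_one s hrs
    exact ⟨e, r * u * s', (hru.mul hu).mul hs'u, he, fun i ↦ congruence_transfer hr hs' hcong i⟩

/-! ### §5 Toy certificate for R-g15-1 (unique residue map of a local ring onto `𝔽₃`) -/

/-- **A local ring has at most one ring map to `𝔽₃`.** (Both kernels are the maximal ideal; ring maps to `ZMod n` are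
determined by their kernel.) Used in `NodeNguyenEpwWildPort.md` §KEEP/KILL, refinement R-g15-1 of g14's JT-a: for the
local Artinian Hecke ring `𝕋_𝔪/3` the two reductions `J₀(L)[𝔪] → E[3]`, `→ E′[3]` factor through THE residue map, so
transport of Σ-stabilised Kummer classes is free precisely in multiplicity one. [folklore] -/
theorem ringHom_zmod_three_unique {A : Type*} [CommRing A] [IsLocalRing A] (f g : A →+* ZMod 3) : f = g := by
  apply ZMod.ringHom_eq_of_ker_eq
  rw [IsLocalRing.eq_maximalIdeal (RingHom.ker_isMaximal_of_surjective f (ZMod.ringHom_surjective f)),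
    IsLocalRing.eq_maximalIdeal (RingHom.ker_isMaximal_of_surjective g (ZMod.ringHom_surjective g))]

end Summit.BirchSwinnertonDyer.BirchSwinnertonDyer.Cruxes.SigmaCongruenceAtThree.NguyenEpwWildPort

end
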